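import Mathlib
import HarnessLib
import Summits.AtomisticToContinuum.Crystallization.Theses.LaminarSixThreeThree
import Summits.AtomisticToContinuum.Crystallization.Theses.SquareWellLayerCake
import Summits.AtomisticToContinuum.Crystallization.Theorems.SquareWellLayerCakeStackingFaultSparsityOfLaminarBarlowWindows
import Summits.AtomisticToContinuum.Crystallization.Theorems.SquareWellLayerCakeStackingFaultSparsityQualitativeRigidity
import Summits.AtomisticToContinuum.Crystallization.Theorems.SquareWellLayerCakeStackingFaultSparsityLocalFramesDichotomy
import Summits.AtomisticToContinuum.Crystallization.Theorems.SquareWellLayerCakeStackingFaultSparsityLocalFramesCommonNormal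
import Summits.AtomisticToContinuum.Crystallization.Theorems.SquareWellLayerCakeStackingFaultSparsityLocalFramesOneLength
import Summits.AtomisticToContinuum.Crystallization.Theorems.SquareWellLayerCakeStackingFaultSparsityLocalFramesFinal
import Summits.AtomisticToContinuum.Crystallization.Theorems.SquareWellLayerCakeStackingFaultSparsityLocalFramesLimit
import Summits.AtomisticToContinuum.Crystallization.Theorems.SquareWellLayerCakeStackingFaultSparsityLocalFramesBoard
import Summits.AtomisticToContinuum.Crystallization.Theorems.SquareWellLayerCakeStackingFaultSparsityBootstrapGlue

/-!
# Line `Sketch` for the crux `StackingFaultSparsity` (stmt-AtomisticToContinuum-14296) — RESHAPE 15, FINAL FORM (lead c8)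

History.  Reshapes 1–7 (leads c0–c6) reduced the crux to the X-type input `LaminarBarlowWindows` (item 14292;
`StackingFaultSparsity_of_laminarBarlowWindows'`, p141795).  Reshape 10 (lead c7) LANDED the qualitative laminar
rigidity (p150153): `LjLaminarity → LaminarSaturation → StackingFaultSparsity`.  Reshapes 11–13 (lead c7) opened item
14294 `LaminarSaturation`, BYPASSED its radius bootstrap by an exact local-to-global structure theorem for
everywhere-locally-framed point sets, and LANDED every geometric stub of that cut (S0 p155360, S12 p153940, S3 p153553,
S4 p153464, glue p152990/p153203/p153916/p154475, board p156012): the crux — and items 14292, 3240, 11778 — are closed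
modulo EXACTLY {item 14293 `LjLaminarity`, 14294's registered radius-2 energy stub `stub_energyGap`}.

**Reshape 14** (this lead) opens item 14294 along ITS registered birth skeleton
(`Cruxes/LaminarSaturation/Lines/birth.lean`: `LaminarSaturation ⇐ stub_energyGap + stub_radiusBootstrap`) and PROVES its
second registered stub `stub_radiusBootstrap` — the finite-`N` counting bootstrap
`#¬GOOD(R, ε) ≤ C · (#¬GOOD(2, ε') + #¬LAM(t, R'))` over Lennard-Jones ground states — from the landed local-frames
machinery, so that item 14294 closes the moment its radius-2 energy stub does (no separate bootstrap) and the laminar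
board's residual is certified to be {14293, energyGap} ≡ {14293 ∧ 14294}.  Mechanism (the corrected plan recorded on
14294, evidence `RadiusBootstrap-14294-plan.md`: the birth card's frame GLUING fails at fcc sites, which admit four
`GOOD(2,1,0)` axes, so the common frame must be read off a Barlow WINDOW): strengthened local rigidity (all-GOOD
`m`-balls force a two-way matched Barlow window whose parameters satisfy `a, √(a²/3+h²) ∈ [19/20, 1]`, `h ≥ 19/25` —
the limit stacking inherits the exact frames' bounds; in the two-length case the level gap is `≥ 19/25` by the global
level-gap dichotomy of S3's proof, in the one-length case `h = a√(2/3) ≥ 0.7757`), the relaxed Barlow shell census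
(within `6/5` of a site: 6 in-layer at `a`, 3 + 3 adjacent at `√(a²/3+h²)`, nothing else), the frame count (a
`GOOD(2, η)` site has exactly 12 particles within distance 1), the window READ-BACK (common normal = image of the
stacking axis, levels `k h`, labels by rounding, counts by injecting each 12-shell into the stacking's 12-shell), and the
packing count `card_exists_near_not_le` with `LennardJonesMinimalDistance_holds`.

Reshape 14 registered seven stubs — the two X-type ones plus W1 `stub_shellCensus`, W2 `stub_gapBound`, W3
`stub_strongRigidity`, W4 `stub_frameCount`, W5 `stub_radiusBootstrap_of` — and wave 1 LANDED W1–W4 within 11 minutes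
(p159493, p159330, p159339, p159331); the lead's glue W5 is proved (`…BootstrapGlue.lean`: `readBack_core`, `radiusBootstrap_of`)
but its 10.5 kB signature exceeds the ledger's 3900-character stub-signature cap, so **reshape 15** registers the SHORT form instead:

Registered stubs of reshape 15 (three): the two X-type ones and `stub_radiusBootstrap` — 14294's registered second stub
VERBATIM — which LANDED as `…Bootstrap.Glue.stub_radiusBootstrap` (p160088, from the landed W1–W4 by the window read-back
`readBack_core` + packing count).  This FINAL FORM plugs it in BY NAME; remaining sorries (two, both X-type):
* `stub_laminarity : LjLaminarity` — item stmt-14293 VERBATIM (open-problem grade);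
* `stub_energyGap` — 14294's registered radius-2 energy stub VERBATIM (XL physics).

Composition (sorry-free): `laminarSaturation_of_stubs : LaminarSaturation` — ITEM 14294 BY NAME from `stub_energyGap` alone
(the birth skeleton's assembly, ported; bootstrap = the landed theorem); `StackingFaultSparsity_proof` / `StackingFaultSparsity_of`
(both route copies BY NAME) by p150153; reshape 13's board route kept as `…_board` theorems (p156012).
END STATE: the crux, item 14292, item 14294, crux 3240, item 11778 are ALL closed modulo EXACTLY {item 14293 `LjLaminarity`,
14294's registered radius-2 energy stub `stub_energyGap`} — the irreducible physics of the laminar board; every geometric /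
bookkeeping step of both cuts (saturation route and local-frames route) is a landed theorem.

Disproof.lean (cdisprove, @2026-08-16T22:41Z, unchanged): no `-- Targets`; §3 (ground state load-bearing: enters through
both X-type stubs and the packing count) and §7 (fcc shells counted: removed only through Barlow windows + the landed
dilute-faults selection) honoured.
-/

noncomputable section

namespace Summit.AtomisticToContinuum.Crystallization.Cruxes.StackingFaultSparsity.Sketch

open Filter Topology
open Literature.MathematicalPhysics.StatisticalMechanics
open Summit.AtomisticToContinuum.Crystallization.Theses.LaminarSixThreeThree

/-! ## X-type stubs (other cruxes' statements verbatim) -/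

/-- **Stub X1 — LAMINARITY a.e.** (= item stmt-AtomisticToContinuum-14293 `LjLaminarity`, verbatim by name;
open-problem grade). -/
theorem stub_laminarity : LjLaminarity := by
  sorry

/-- **Stub X2 — LAMINAR LOCAL ENERGY INEQUALITY at window radius 2** (= the registered stub `stub_energyGap`
of crux stmt-AtomisticToContinuum-14294 `LaminarSaturation`, verbatim; XL physics). -/
theorem stub_energyGap :
    ∀ ε : ℝ, 0 < ε → ∃ t R₀ γ C : ℝ, 0 < t ∧ 0 < R₀ ∧ 0 < γ ∧ 0 ≤ C ∧ ∃ s : ℕ → ℝ, Filter.Tendsto (fun N : ℕ => s N / (N : ℝ)) Filter.atTop (nhds 0) ∧ ∀ (N : ℕ) (y : Fin N → EuclideanSpace ℝ (Fin 3)), Literature.MathematicalPhysics.StatisticalMechanics.IsGroundState Literature.MathematicalPhysics.StatisticalMechanics.lennardJones y → γ * (Nat.card {i : Fin N // ¬ (∃ a b : ℝ, 19 / 20 ≤ a ∧ a ≤ 1 ∧ 19 / 20 ≤ b ∧ b ≤ 1 ∧ ∃ n : EuclideanSpace ℝ (Fin 3), ‖n‖ = 1 ∧ ∃ c : ℤ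 → ℝ, (∀ k : ℤ, c k + 19 / 25 ≤ c (k + 1)) ∧ ∃ l : Fin N → ℤ, (∀ j : Fin N, dist (y j) (y i) ≤ 2 → |inner ℝ (y j - y i) n - c (l j)| ≤ ε) ∧ (∀ j k : Fin N, dist (y j) (y i) ≤ 2 → dist (y k) (y i) ≤ 2 → j ≠ k → 19 / 20 ≤ dist (y j) (y k)) ∧ ∀ j : Fin N, dist (y j) (y i) ≤ 1 → Nat.card {k : Fin N // k ≠ j ∧ l k = l j ∧ dist (y j) (y k) ≤ 1} = 6 ∧ Nat.card {k : Fin N // l k = l j + 1 ∧ dist (y j) (y k) ≤ 1} = 3 ∧ Nat.card {k : Fin N // l k = l j - 1 ∧ dist (y j) (y k) ≤ 1} = 3 ∧ ∀ k : Fin N, k ≠ j → dist (y j) (y k) ≤ 1 → (l k = l j → |dist (y j) (y k) - a| ≤ ε) ∧ (l k ≠ l j → |dist (y j) (y k) - b| ≤ ε))} : ℝ) ≤ (Literature.MathematicalPhysics.StatisticalMechanics.interactionEnergy Literature.MathematicalPhysics.StatisticalMechanics.lennardJones y - (N : ℝ) * (⨅ Q : Literature.MathematicalPhysics.StatisticalMechanics.PeriodicConfiguration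 3, Q.energyPerParticle Literature.MathematicalPhysics.StatisticalMechanics.lennardJones)) + C * (Nat.card {i : Fin N // ¬ (∃ n : EuclideanSpace ℝ (Fin 3), ‖n‖ = 1 ∧ ∃ c : ℤ → ℝ, (∀ k : ℤ, c k + 3 / 4 ≤ c (k + 1)) ∧ ∀ j : Fin N, dist (y j) (y i) ≤ R₀ → ∃ k : ℤ, |inner ℝ (y j - y i) n - c k| ≤ t)} : ℝ) + s N := by
  sorry

/-! ## Composition (sorry-free) -/

/-- Real-analysis core of 14294's birth assembly (ported verbatim from `Cruxes/LaminarSaturation/Lines/birth.lean`):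
a density squeezed between `0` and `C₂ · ((excess energy density + C₁ · density₂ + s/N) / γ + density₁)`. [folklore] -/
theorem tendsto_density_of_gap_of_bootstrap {f b g₁ g₂ E s : ℕ → ℝ} {γ C₁ C₂ e : ℝ}
    (hγ : 0 < γ) (hC₂ : 0 ≤ C₂)
    (hboot : ∀ N, f N ≤ C₂ * (b N + g₁ N))
    (hgap : ∀ N, γ * b N ≤ (E N - (N : ℝ) * e) + C₁ * g₂ N + s N)
    (hf : ∀ N, 0 ≤ f N)
    (hg₁ : Tendsto (fun N : ℕ => g₁ N / (N : ℝ)) atTop (𝓝 0))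
    (hg₂ : Tendsto (fun N : ℕ => g₂ N / (N : ℝ)) atTop (𝓝 0))
    (hE : Tendsto (fun N : ℕ => E N / (N : ℝ)) atTop (𝓝 e))
    (hs : Tendsto (fun N : ℕ => s N / (N : ℝ)) atTop (𝓝 0)) :
    Tendsto (fun N : ℕ => f N / (N : ℝ)) atTop (𝓝 0) := by
  have hup : Tendsto (fun N : ℕ =>
      C₂ * (((E N / (N : ℝ) - e) + C₁ * (g₂ N / (N : ℝ)) + s N / (N : ℝ)) / γ + g₁ N / (N : ℝ)))
      atTop (𝓝 0) := by
    have h1 : Tendsto (fun N : ℕ => E N / (N : ℝ) - e) atTop (𝓝 0) := by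
      simpa using hE.sub_const e
    have h2 := (((h1.add (hg₂.const_mul C₁)).add hs).div_const γ).add hg₁
    simpa using h2.const_mul C₂
  refine tendsto_of_tendsto_of_tendsto_of_le_of_le' tendsto_const_nhds hup ?_ ?_
  · exact Filter.Eventually.of_forall fun N => div_nonneg (hf N) (Nat.cast_nonneg N)
  · filter_upwards [Filter.eventually_gt_atTop 0] with N hN
    have hN : (0 : ℝ) < N := Nat.cast_pos.mpr hN
    have hb : b N ≤ ((E N - (N : ℝ) * e) + C₁ * g₂ N + s N) / γ := by
      rw [le_div_iff₀ hγ]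
      linarith [hgap N]
    have hfN : f N ≤ C₂ * (((E N - (N : ℝ) * e) + C₁ * g₂ N + s N) / γ + g₁ N) :=
      (hboot N).trans (mul_le_mul_of_nonneg_left (add_le_add hb le_rfl) hC₂)
    have hdiv : f N / (N : ℝ) ≤ C₂ * (((E N - (N : ℝ) * e) + C₁ * g₂ N + s N) / γ + g₁ N) / (N : ℝ) :=
      div_le_div_of_nonneg_right hfN hN.le
    refine hdiv.trans (le_of_eq ?_)
    field_simp

/-- **Item 14294 `LaminarSaturation` BY NAME from its radius-2 energy stub alone** (the birth skeleton's assembly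
`LaminarSaturation_of`, ported, with the LANDED bootstrap `Bootstrap.Glue.stub_radiusBootstrap` (p160088): bootstrap at
`(R, ε)`, energy gap at `ε'`, `LjLaminarity` at the two laminarity scales, `CrysEnergyLimit_holds`, squeeze). -/
theorem laminarSaturation_of_stubs : LaminarSaturation := by
  intro hLam R ε hR hε x hx
  obtain ⟨ε', t₁, R₁, C₂, hε', ht₁, hR₁, hC₂, hboot⟩ :=
    Summit.AtomisticToContinuum.Crystallization.Theorems.SquareWellLayerCake.StackingFaultSparsity.Bootstrap.Glue.stub_radiusBootstrap
      R ε hR hε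
  obtain ⟨t₂, R₂, γ, C₁, ht₂, hR₂, hγ, _hC₁, s, hs, hgap⟩ := stub_energyGap ε' hε'
  have h0 : Tendsto (fun N : ℕ => groundStateEnergy lennardJones 3 N / (N : ℝ)) atTop
      (𝓝 (⨅ Q : Literature.MathematicalPhysics.StatisticalMechanics.PeriodicConfiguration 3,
        Q.energyPerParticle Literature.MathematicalPhysics.StatisticalMechanics.lennardJones)) :=
    CrysEnergyLimit_holds
  exact tendsto_density_of_gap_of_bootstrap hγ hC₂ (fun N => hboot N (x N) (hx N))
    (fun N => hgap N (x N) (hx N)) (fun N => Nat.cast_nonneg _) (hLam t₁ R₁ ht₁ hR₁ x hx)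
    (hLam t₂ R₂ ht₂ hR₂ x hx) (h0.congr fun N => by rw [(hx N).2]) hs

/-- **The crux `LaminarSixThreeThree.StackingFaultSparsity` BY NAME** (p150153: the crux from 14293 ∧ 14294). -/
theorem StackingFaultSparsity_proof :
    Summit.AtomisticToContinuum.Crystallization.Theses.LaminarSixThreeThree.StackingFaultSparsity :=
  Summit.AtomisticToContinuum.Crystallization.Theorems.SquareWellLayerCake.StackingFaultSparsity.QualitativeRigidity.StackingFaultSparsity_of_laminarity_saturation
    stub_laminarity laminarSaturation_of_stubs

/-- **The crux `SquareWellLayerCake.StackingFaultSparsity` BY NAME** (sibling copy). -/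
theorem StackingFaultSparsity_of :
    Summit.AtomisticToContinuum.Crystallization.Theses.SquareWellLayerCake.StackingFaultSparsity :=
  Summit.AtomisticToContinuum.Crystallization.Theorems.SquareWellLayerCake.StackingFaultSparsity.QualitativeRigidity.StackingFaultSparsity_of_laminarity_saturation'
    stub_laminarity laminarSaturation_of_stubs

/-! ## Reshape 13's board route stays valid (landed p156012): the crux from the two X-type stubs alone -/

/-- `LaminarBarlowWindows` (item 14292) from the two X-type stubs by the landed board theorem. -/
theorem laminarBarlowWindows_board : LaminarBarlowWindows :=
  Summit.AtomisticToContinuum.Crystallization.Theorems.SquareWellLayerCake.StackingFaultSparsity.LocalFrames.Board.laminarBarlowWindows_of_laminarity_energyGap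
    stub_laminarity stub_energyGap

/-- The crux (route `LaminarSixThreeThree` copy) by the board route. -/
theorem StackingFaultSparsity_board :
    Summit.AtomisticToContinuum.Crystallization.Theses.LaminarSixThreeThree.StackingFaultSparsity :=
  Summit.AtomisticToContinuum.Crystallization.Theorems.SquareWellLayerCake.StackingFaultSparsity.LocalFrames.Board.stackingFaultSparsity_of_laminarity_energyGap
    stub_laminarity stub_energyGap

end Summit.AtomisticToContinuum.Crystallization.Cruxes.StackingFaultSparsity.Sketch

end
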